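import Mathlib
import Summits.PneNP.PneNP.Theorems.OverlapGapAlgebraSolvableImpliesStableSectionMonotoneRepairTreeCompose

/-!
# PneNP / OverlapGapAlgebra — crux `SolvableImpliesStableSection` (stmt-PneNP-2463):
# the TWO-WAY REPAIR block (2/·) — validity of an assembled code from its subtrees

Support for crux `stmt-PneNP-2463` (`Summit.PneNP.PneNP.Theses.OverlapGapAlgebra.SolvableImpliesStableSection`):
the f-free block "bounded-round two-way repair with one-round memory gives stable sections for every
`ν > 0` up to `α ≤ 2^k/(4k)`".  Labels of the tree codes are `(x, c)` with the CODE `c = 2·round + τ`.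
Two predicates on a code `T`:
* SYNTACTIC VALIDITY in `Φ` (two-way sign rule): at node `(a, (x, c))` and slot `j`, the sign of
  `(x, j)` is positive iff a child of even code hangs at `j :: a` or the slot is childless and `c` is
  odd; and the variable of a child-bearing slot equals the variable of the least childless slot of the
  child's clause;
* LOCAL VALIDITY (instance-free): children have smaller rounds and a childless slot, children of odd
  code have at most one childless slot, and EVERY node of round `≥ 1` has a child of the preceding
  round (no dead roots: the two-way rule repairs every violated clause).
This file transports both through the assembling operation `asm` of `…MonotoneRepairTreeAsm`:

* `sissW_synv_asm` — syntactic validity of `asm c r ch` from that of the subtrees, the root's sign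
  pattern and the edge equations;
* `sissW_locv_asm_of` / `sissW_locv_asm_imp` — local validity of `asm c r ch` versus local validity,
  a childless root slot, uniqueness of the childless root slot for odd codes and a smaller root round
  for every subtree, plus recency at the root.
No definitions (all objects are hypotheses); axioms `propext`, `Classical.choice`, `Quot.sound`.
-/

set_option linter.dupNamespace false -- `Summit.PneNP.PneNP.…`: summit = sub-problem (D-0017)

namespace Summit.PneNP.PneNP.Theorems

open Finset
open scoped Classical

section TreeCompose

variable {m k n : ℕ}

/-- **Syntactic validity of an assembled code (two-way sign rule).** If the root's sign at slot `j`
is positive exactly when `ch j` is a subtree of even root code or `ch j` is absent and `r` is odd,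
every subtree is syntactically valid with a unique root, and every edge equation holds (the variable
of the root slot `j` equals the variable of the least childless root slot of `ch j`), then
`asm c r ch` is syntactically valid. -/
theorem sissW_synv_asm (asm : Fin m → ℕ → (Fin k → Option (Finset (List (Fin k) × (Fin m × ℕ)))) → Finset (List (Fin k) × (Fin m × ℕ)))
    (hasm : ∀ (c : Fin m) (r : ℕ) (ch : Fin k → Option (Finset (List (Fin k) × (Fin m × ℕ))))
      (e : (List (Fin k) × (Fin m × ℕ))), e ∈ asm c r ch ↔ (e = ([], (c, r)) ∨
      ∃ (j : Fin k) (S : Finset (List (Fin k) × (Fin m × ℕ))), ch j = some S ∧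
        ∃ b : List (Fin k), (b, e.2) ∈ S ∧ e.1 = b ++ [j]))
    (Φ : Fin m → Fin k → Fin n × Bool) (c : Fin m) (r : ℕ) (ch : Fin k → Option (Finset (List (Fin k) × (Fin m × ℕ))))
    (hsign : ∀ j : Fin k, (Φ c j).2 = true ↔
      ((∃ (S : Finset (List (Fin k) × (Fin m × ℕ))) (y : Fin m) (s : ℕ), ch j = some S ∧ (([] : List (Fin k)), (y, s)) ∈ S ∧
        s % 2 = 0) ∨ (ch j = none ∧ r % 2 = 1)))
    (hfun : ∀ (j : Fin k) (S : Finset (List (Fin k) × (Fin m × ℕ))), ch j = some S → ∀ lab lab' : Fin m × ℕ,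
      (([] : List (Fin k)), lab) ∈ S → (([] : List (Fin k)), lab') ∈ S → lab = lab')
    (hch : ∀ (j : Fin k) (S : Finset (List (Fin k) × (Fin m × ℕ))), ch j = some S →
      (∀ e ∈ S, ∀ j : Fin k,
      (((Φ e.2.1 j).2 = true ↔ ((∃ (y : Fin m) (s : ℕ), (j :: e.1, (y, s)) ∈ S ∧ s % 2 = 0) ∨
        ((∀ lab : Fin m × ℕ, (j :: e.1, lab) ∉ S) ∧ e.2.2 % 2 = 1))) ∧
      ∀ (y : Fin m) (s : ℕ), (j :: e.1, (y, s)) ∈ S → ∃ j' : Fin k,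
        (∀ lab : Fin m × ℕ, (j' :: j :: e.1, lab) ∉ S) ∧
        (∀ j'' : Fin k, j'' < j' → ∃ lab : Fin m × ℕ, (j'' :: j :: e.1, lab) ∈ S) ∧
        (Φ e.2.1 j).1 = (Φ y j').1)) ∧
      ∃ (y : Fin m) (s : ℕ), (([] : List (Fin k)), (y, s)) ∈ S ∧ ∃ j' : Fin k,
        (∀ lab : Fin m × ℕ, ([j'], lab) ∉ S) ∧
        (∀ j'' : Fin k, j'' < j' → ∃ lab : Fin m × ℕ, ([j''], lab) ∈ S) ∧
        (Φ c j).1 = (Φ y j').1) :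
    ∀ e ∈ asm c r ch, ∀ j : Fin k,
      (((Φ e.2.1 j).2 = true ↔ ((∃ (y : Fin m) (s : ℕ), (j :: e.1, (y, s)) ∈ asm c r ch ∧ s % 2 = 0) ∨
        ((∀ lab : Fin m × ℕ, (j :: e.1, lab) ∉ asm c r ch) ∧ e.2.2 % 2 = 1))) ∧
      ∀ (y : Fin m) (s : ℕ), (j :: e.1, (y, s)) ∈ asm c r ch → ∃ j' : Fin k,
        (∀ lab : Fin m × ℕ, (j' :: j :: e.1, lab) ∉ asm c r ch) ∧
        (∀ j'' : Fin k, j'' < j' → ∃ lab : Fin m × ℕ, (j'' :: j :: e.1, lab) ∈ asm c r ch) ∧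
        (Φ e.2.1 j).1 = (Φ y j').1) := by
  intro e he j₁
  obtain ⟨a, lab₀⟩ := e
  rcases sissR_asm_cases asm hasm c r ch _ he with ⟨ha, hl⟩ | ⟨j, S, b, hS, hb, hab⟩
  · -- the root
    simp only at ha hl
    subst ha; subst hl
    constructor
    · rw [hsign j₁]
      refine or_congr ⟨?_, ?_⟩ ⟨?_, ?_⟩
      · rintro ⟨S, y, s, hS, hys, hpar⟩
        exact ⟨y, s, (sissR_asm_mem_single asm hasm c r ch j₁ (y, s)).2 ⟨S, hS, hys⟩, hpar⟩
      · rintro ⟨y, s, hys, hpar⟩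
        obtain ⟨S, hS, hys'⟩ := (sissR_asm_mem_single asm hasm c r ch j₁ (y, s)).1 hys
        exact ⟨S, y, s, hS, hys', hpar⟩
      · rintro ⟨hnone, hodd⟩
        refine ⟨fun lab hlab => ?_, hodd⟩
        obtain ⟨S, hS, _⟩ := (sissR_asm_mem_single asm hasm c r ch j₁ lab).1 hlab
        rw [hnone] at hS
        exact absurd hS (by simp)
      · rintro ⟨hno, hodd⟩
        refine ⟨?_, hodd⟩
        cases hS : ch j₁ with
        | none => rfl
        | some S =>
          obtain ⟨_, y, s, hys, _⟩ := hch j₁ S hS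
          exact absurd ((sissR_asm_mem_single asm hasm c r ch j₁ (y, s)).2 ⟨S, hS, hys⟩) (hno (y, s))
    · intro y s hys
      obtain ⟨S, hS, hys'⟩ := (sissR_asm_mem_single asm hasm c r ch j₁ (y, s)).1 hys
      obtain ⟨_, y₀, s₀, hy₀, j', hno, hlt, heq⟩ := hch j₁ S hS
      have hyy : (y, s) = (y₀, s₀) := hfun j₁ S hS _ _ hys' hy₀
      rw [Prod.mk.injEq] at hyy
      obtain ⟨rfl, rfl⟩ := hyy
      refine ⟨j', fun lab hlab => ?_, fun j'' hj'' => ?_, heq⟩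
      · rw [show (j' :: [j₁] : List (Fin k)) = j' :: ([] ++ [j₁]) from rfl,
          sissR_asm_mem_cons_concat asm hasm] at hlab
        obtain ⟨S', hS', h'⟩ := hlab
        rw [hS] at hS'
        cases hS'
        exact hno lab h'
      · obtain ⟨lab, hlab⟩ := hlt j'' hj''
        refine ⟨lab, ?_⟩
        rw [show (j'' :: [j₁] : List (Fin k)) = j'' :: ([] ++ [j₁]) from rfl,
          sissR_asm_mem_cons_concat asm hasm]
        exact ⟨S, hS, hlab⟩
  · -- a shifted element `(b ++ [j], lab₀)` of the subtree `S`
    simp only at hb hab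
    subst hab
    obtain ⟨hsynS, _⟩ := hch j S hS
    obtain ⟨hsgn, hchild⟩ := hsynS (b, lab₀) hb j₁
    constructor
    · rw [hsgn]
      refine or_congr ⟨?_, ?_⟩ (and_congr_left fun _ => ⟨?_, ?_⟩)
      · rintro ⟨y, s, hys, hpar⟩
        exact ⟨y, s, (sissR_asm_mem_cons_concat asm hasm c r ch b j j₁ (y, s)).2 ⟨S, hS, hys⟩, hpar⟩
      · rintro ⟨y, s, hys, hpar⟩
        obtain ⟨S', hS', h'⟩ := (sissR_asm_mem_cons_concat asm hasm c r ch b j j₁ (y, s)).1 hys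
        rw [hS] at hS'
        cases hS'
        exact ⟨y, s, h', hpar⟩
      · intro hno lab hlab
        obtain ⟨S', hS', h'⟩ := (sissR_asm_mem_cons_concat asm hasm c r ch b j j₁ lab).1 hlab
        rw [hS] at hS'
        cases hS'
        exact hno lab h'
      · intro hno lab hlab
        exact hno lab ((sissR_asm_mem_cons_concat asm hasm c r ch b j j₁ lab).2 ⟨S, hS, hlab⟩)
    · intro y s hys
      obtain ⟨S', hS', hys'⟩ := (sissR_asm_mem_cons_concat asm hasm c r ch b j j₁ (y, s)).1 hys
      rw [hS] at hS'
      cases hS'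
      obtain ⟨j', hno, hlt, heq⟩ := hchild y s hys'
      refine ⟨j', fun lab hlab => ?_, fun j'' hj'' => ?_, heq⟩
      · rw [show (j' :: j₁ :: (b ++ [j]) : List (Fin k)) = j' :: ((j₁ :: b) ++ [j]) from rfl,
          sissR_asm_mem_cons_concat asm hasm] at hlab
        obtain ⟨S', hS', h'⟩ := hlab
        rw [hS] at hS'
        cases hS'
        exact hno lab h'
      · obtain ⟨lab, hlab⟩ := hlt j'' hj''
        refine ⟨lab, ?_⟩
        rw [show (j'' :: j₁ :: (b ++ [j]) : List (Fin k)) = j'' :: ((j₁ :: b) ++ [j]) from rfl,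
          sissR_asm_mem_cons_concat asm hasm]
        exact ⟨S, hS, hlab⟩

/-- Childlessness above a shifted address of `asm c r ch` is childlessness in the subtree. -/
theorem sissW_childless_shift (asm : Fin m → ℕ → (Fin k → Option (Finset (List (Fin k) × (Fin m × ℕ)))) → Finset (List (Fin k) × (Fin m × ℕ)))
    (hasm : ∀ (c : Fin m) (r : ℕ) (ch : Fin k → Option (Finset (List (Fin k) × (Fin m × ℕ))))
      (e : (List (Fin k) × (Fin m × ℕ))), e ∈ asm c r ch ↔ (e = ([], (c, r)) ∨
      ∃ (j : Fin k) (S : Finset (List (Fin k) × (Fin m × ℕ))), ch j = some S ∧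
        ∃ b : List (Fin k), (b, e.2) ∈ S ∧ e.1 = b ++ [j]))
    (c : Fin m) (r : ℕ) (ch : Fin k → Option (Finset (List (Fin k) × (Fin m × ℕ)))) (j : Fin k) (S : Finset (List (Fin k) × (Fin m × ℕ))) (hS : ch j = some S)
    (j' : Fin k) (b : List (Fin k)) :
    (∀ lab : Fin m × ℕ, (j' :: (b ++ [j]), lab) ∉ asm c r ch) ↔
      ∀ lab : Fin m × ℕ, (j' :: b, lab) ∉ S := by
  constructor
  · intro h lab hlab
    exact h lab ((sissR_asm_mem_cons_concat asm hasm c r ch b j j' lab).2 ⟨S, hS, hlab⟩)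
  · intro h lab hlab
    obtain ⟨S', hS', h'⟩ := (sissR_asm_mem_cons_concat asm hasm c r ch b j j' lab).1 hlab
    rw [hS] at hS'
    cases hS'
    exact h lab h'

/-- **Local validity of an assembled code (two-way rule).** If every subtree `ch j = some S` is
locally valid, has a childless root slot — exactly one when its root code is odd — and a unique root of
round `< r/2`, and the root is recent (`r/2 ≥ 1` implies that some subtree has root round `r/2 - 1`),
then `asm c r ch` is locally valid. -/
theorem sissW_locv_asm_of (asm : Fin m → ℕ → (Fin k → Option (Finset (List (Fin k) × (Fin m × ℕ)))) → Finset (List (Fin k) × (Fin m × ℕ)))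
    (hasm : ∀ (c : Fin m) (r : ℕ) (ch : Fin k → Option (Finset (List (Fin k) × (Fin m × ℕ))))
      (e : (List (Fin k) × (Fin m × ℕ))), e ∈ asm c r ch ↔ (e = ([], (c, r)) ∨
      ∃ (j : Fin k) (S : Finset (List (Fin k) × (Fin m × ℕ))), ch j = some S ∧
        ∃ b : List (Fin k), (b, e.2) ∈ S ∧ e.1 = b ++ [j]))
    (c : Fin m) (r : ℕ) (ch : Fin k → Option (Finset (List (Fin k) × (Fin m × ℕ))))
    (hfun : ∀ (j : Fin k) (S : Finset (List (Fin k) × (Fin m × ℕ))), ch j = some S → ∀ lab lab' : Fin m × ℕ,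
      (([] : List (Fin k)), lab) ∈ S → (([] : List (Fin k)), lab') ∈ S → lab = lab')
    (hch : ∀ (j : Fin k) (S : Finset (List (Fin k) × (Fin m × ℕ))), ch j = some S →
      (((∀ e ∈ S, ∀ (j : Fin k) (y : Fin m) (s : ℕ), (j :: e.1, (y, s)) ∈ S →
        s / 2 < e.2.2 / 2 ∧ ∃ j' : Fin k, ∀ lab : Fin m × ℕ, (j' :: j :: e.1, lab) ∉ S) ∧
      (∀ e ∈ S, ∀ (j : Fin k) (y : Fin m) (s : ℕ), (j :: e.1, (y, s)) ∈ S → s % 2 = 1 →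
        ∀ j₁ j₂ : Fin k, (∀ lab : Fin m × ℕ, (j₁ :: j :: e.1, lab) ∉ S) →
          (∀ lab : Fin m × ℕ, (j₂ :: j :: e.1, lab) ∉ S) → j₁ = j₂) ∧
      (∀ e ∈ S, 1 ≤ e.2.2 / 2 → ∃ (j : Fin k) (y : Fin m) (s : ℕ),
        (j :: e.1, (y, s)) ∈ S ∧ s / 2 + 1 = e.2.2 / 2))) ∧ (∃ j : Fin k, ∀ lab : Fin m × ℕ, ([j], lab) ∉ S) ∧ ((∀ (y : Fin m) (s : ℕ), (([] : List (Fin k)), (y, s)) ∈ S → s % 2 = 1 →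
        ∀ j₁ j₂ : Fin k, (∀ lab : Fin m × ℕ, ([j₁], lab) ∉ S) →
          (∀ lab : Fin m × ℕ, ([j₂], lab) ∉ S) → j₁ = j₂)) ∧
      ∃ (y : Fin m) (s : ℕ), (([] : List (Fin k)), (y, s)) ∈ S ∧ s / 2 < r / 2)
    (hrec : 1 ≤ r / 2 → ∃ (j : Fin k) (S : Finset (List (Fin k) × (Fin m × ℕ))) (y : Fin m) (s : ℕ), ch j = some S ∧
        (([] : List (Fin k)), (y, s)) ∈ S ∧ s / 2 + 1 = r / 2) :
    ((∀ e ∈ asm c r ch, ∀ (j : Fin k) (y : Fin m) (s : ℕ), (j :: e.1, (y, s)) ∈ asm c r ch →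
        s / 2 < e.2.2 / 2 ∧ ∃ j' : Fin k, ∀ lab : Fin m × ℕ, (j' :: j :: e.1, lab) ∉ asm c r ch) ∧
      (∀ e ∈ asm c r ch, ∀ (j : Fin k) (y : Fin m) (s : ℕ), (j :: e.1, (y, s)) ∈ asm c r ch → s % 2 = 1 →
        ∀ j₁ j₂ : Fin k, (∀ lab : Fin m × ℕ, (j₁ :: j :: e.1, lab) ∉ asm c r ch) →
          (∀ lab : Fin m × ℕ, (j₂ :: j :: e.1, lab) ∉ asm c r ch) → j₁ = j₂) ∧
      (∀ e ∈ asm c r ch, 1 ≤ e.2.2 / 2 → ∃ (j : Fin k) (y : Fin m) (s : ℕ),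
        (j :: e.1, (y, s)) ∈ asm c r ch ∧ s / 2 + 1 = e.2.2 / 2)) := by
  refine ⟨?_, ?_, ?_⟩
  · intro e he j₁ y s hys
    obtain ⟨a, lab₀⟩ := e
    rcases sissR_asm_cases asm hasm c r ch _ he with ⟨ha, hl⟩ | ⟨j, S, b, hS, hb, hab⟩
    · -- child of the root
      simp only at ha hl
      subst ha; subst hl
      obtain ⟨S, hS, hys'⟩ := (sissR_asm_mem_single asm hasm c r ch j₁ (y, s)).1 hys
      obtain ⟨_, ⟨j', hj'⟩, _, y₀, s₀, hy₀, hs₀⟩ := hch j₁ S hS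
      have hyy : (y, s) = (y₀, s₀) := hfun j₁ S hS _ _ hys' hy₀
      rw [Prod.mk.injEq] at hyy
      obtain ⟨rfl, rfl⟩ := hyy
      refine ⟨hs₀, j', ?_⟩
      rw [show (j₁ :: ([] : List (Fin k))) = [] ++ [j₁] from rfl, sissW_childless_shift asm hasm c r ch j₁ S hS]
      exact hj'
    · -- child of a shifted element
      simp only at hb hab hys
      subst hab
      obtain ⟨S', hS', hys'⟩ := (sissR_asm_mem_cons_concat asm hasm c r ch b j j₁ (y, s)).1 hys
      rw [hS] at hS'
      cases hS'
      obtain ⟨⟨hloc1, _, _⟩, _⟩ := hch j S hS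
      obtain ⟨hs, j', hj'⟩ := hloc1 (b, lab₀) hb j₁ y s hys'
      refine ⟨hs, j', ?_⟩
      rw [show (j₁ :: (b ++ [j]) : List (Fin k)) = (j₁ :: b) ++ [j] from rfl,
        sissW_childless_shift asm hasm c r ch j S hS]
      exact hj'
  · intro e he j₁ y s hys hodd i₁ i₂ hi₁ hi₂
    obtain ⟨a, lab₀⟩ := e
    rcases sissR_asm_cases asm hasm c r ch _ he with ⟨ha, hl⟩ | ⟨j, S, b, hS, hb, hab⟩
    · -- child of the root: uniqueness from `UNIQW S`
      simp only at ha hl hys hi₁ hi₂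
      subst ha; subst hl
      obtain ⟨S, hS, hys'⟩ := (sissR_asm_mem_single asm hasm c r ch j₁ (y, s)).1 hys
      obtain ⟨_, _, huniq, _⟩ := hch j₁ S hS
      refine huniq y s hys' hodd i₁ i₂ ?_ ?_
      · rw [← sissW_childless_shift asm hasm c r ch j₁ S hS i₁ []]; exact hi₁
      · rw [← sissW_childless_shift asm hasm c r ch j₁ S hS i₂ []]; exact hi₂
    · simp only at hb hab hys hi₁ hi₂
      subst hab
      obtain ⟨S', hS', hys'⟩ := (sissR_asm_mem_cons_concat asm hasm c r ch b j j₁ (y, s)).1 hys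
      rw [hS] at hS'
      cases hS'
      obtain ⟨⟨_, hloc2, _⟩, _⟩ := hch j S hS
      refine hloc2 (b, lab₀) hb j₁ y s hys' hodd i₁ i₂ ?_ ?_
      · rw [← sissW_childless_shift asm hasm c r ch j S hS i₁ (j₁ :: b)]; exact hi₁
      · rw [← sissW_childless_shift asm hasm c r ch j S hS i₂ (j₁ :: b)]; exact hi₂
  · intro e he h1
    obtain ⟨a, lab₀⟩ := e
    rcases sissR_asm_cases asm hasm c r ch _ he with ⟨ha, hl⟩ | ⟨j, S, b, hS, hb, hab⟩
    · -- the root: recency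
      simp only at ha hl h1 ⊢
      subst ha; subst hl
      obtain ⟨j, S, y, s, hS, hy, hs⟩ := hrec h1
      exact ⟨j, y, s, (sissR_asm_mem_single asm hasm c r ch j (y, s)).2 ⟨S, hS, hy⟩, hs⟩
    · -- a shifted element: recency inside the subtree
      simp only at hb hab h1 ⊢
      subst hab
      obtain ⟨⟨_, _, hloc3⟩, _⟩ := hch j S hS
      obtain ⟨j₁, y, s, hy, hs⟩ := hloc3 (b, lab₀) hb h1
      exact ⟨j₁, y, s, (sissR_asm_mem_cons_concat asm hasm c r ch b j j₁ (y, s)).2 ⟨S, hS, hy⟩, hs⟩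

/-- **Local validity of an assembled code, conversely.** If `asm c r ch` is locally valid and the
present subtrees have unique roots, then every subtree is locally valid with a childless root slot,
a unique one when its root code is odd, root round `< r/2`, and the root is recent. -/
theorem sissW_locv_asm_imp (asm : Fin m → ℕ → (Fin k → Option (Finset (List (Fin k) × (Fin m × ℕ)))) → Finset (List (Fin k) × (Fin m × ℕ)))
    (hasm : ∀ (c : Fin m) (r : ℕ) (ch : Fin k → Option (Finset (List (Fin k) × (Fin m × ℕ))))
      (e : (List (Fin k) × (Fin m × ℕ))), e ∈ asm c r ch ↔ (e = ([], (c, r)) ∨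
      ∃ (j : Fin k) (S : Finset (List (Fin k) × (Fin m × ℕ))), ch j = some S ∧
        ∃ b : List (Fin k), (b, e.2) ∈ S ∧ e.1 = b ++ [j]))
    (c : Fin m) (r : ℕ) (ch : Fin k → Option (Finset (List (Fin k) × (Fin m × ℕ))))
    (hroot : ∀ (j : Fin k) (S : Finset (List (Fin k) × (Fin m × ℕ))), ch j = some S → ∃ lab : Fin m × ℕ, (([] : List (Fin k)), lab) ∈ S)
    (hloc : ((∀ e ∈ asm c r ch, ∀ (j : Fin k) (y : Fin m) (s : ℕ), (j :: e.1, (y, s)) ∈ asm c r ch →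
        s / 2 < e.2.2 / 2 ∧ ∃ j' : Fin k, ∀ lab : Fin m × ℕ, (j' :: j :: e.1, lab) ∉ asm c r ch) ∧
      (∀ e ∈ asm c r ch, ∀ (j : Fin k) (y : Fin m) (s : ℕ), (j :: e.1, (y, s)) ∈ asm c r ch → s % 2 = 1 →
        ∀ j₁ j₂ : Fin k, (∀ lab : Fin m × ℕ, (j₁ :: j :: e.1, lab) ∉ asm c r ch) →
          (∀ lab : Fin m × ℕ, (j₂ :: j :: e.1, lab) ∉ asm c r ch) → j₁ = j₂) ∧
      (∀ e ∈ asm c r ch, 1 ≤ e.2.2 / 2 → ∃ (j : Fin k) (y : Fin m) (s : ℕ),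
        (j :: e.1, (y, s)) ∈ asm c r ch ∧ s / 2 + 1 = e.2.2 / 2))) :
    (∀ (j : Fin k) (S : Finset (List (Fin k) × (Fin m × ℕ))), ch j = some S →
      (((∀ e ∈ S, ∀ (j : Fin k) (y : Fin m) (s : ℕ), (j :: e.1, (y, s)) ∈ S →
        s / 2 < e.2.2 / 2 ∧ ∃ j' : Fin k, ∀ lab : Fin m × ℕ, (j' :: j :: e.1, lab) ∉ S) ∧
      (∀ e ∈ S, ∀ (j : Fin k) (y : Fin m) (s : ℕ), (j :: e.1, (y, s)) ∈ S → s % 2 = 1 →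
        ∀ j₁ j₂ : Fin k, (∀ lab : Fin m × ℕ, (j₁ :: j :: e.1, lab) ∉ S) →
          (∀ lab : Fin m × ℕ, (j₂ :: j :: e.1, lab) ∉ S) → j₁ = j₂) ∧
      (∀ e ∈ S, 1 ≤ e.2.2 / 2 → ∃ (j : Fin k) (y : Fin m) (s : ℕ),
        (j :: e.1, (y, s)) ∈ S ∧ s / 2 + 1 = e.2.2 / 2))) ∧ (∃ j : Fin k, ∀ lab : Fin m × ℕ, ([j], lab) ∉ S) ∧ ((∀ (y : Fin m) (s : ℕ), (([] : List (Fin k)), (y, s)) ∈ S → s % 2 = 1 →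
        ∀ j₁ j₂ : Fin k, (∀ lab : Fin m × ℕ, ([j₁], lab) ∉ S) →
          (∀ lab : Fin m × ℕ, ([j₂], lab) ∉ S) → j₁ = j₂)) ∧
      ∀ (y : Fin m) (s : ℕ), (([] : List (Fin k)), (y, s)) ∈ S → s / 2 < r / 2) ∧
    (1 ≤ r / 2 → ∃ (j : Fin k) (S : Finset (List (Fin k) × (Fin m × ℕ))) (y : Fin m) (s : ℕ), ch j = some S ∧
        (([] : List (Fin k)), (y, s)) ∈ S ∧ s / 2 + 1 = r / 2) := by
  obtain ⟨hloc1, hloc2, hloc3⟩ := hloc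
  have hrootmem : (([] : List (Fin k)), (c, r)) ∈ asm c r ch :=
    (sissR_asm_mem_nil asm hasm c r ch (c, r)).2 rfl
  constructor
  · intro j S hS
    have hmem : ∀ e ∈ S, (e.1 ++ [j], e.2) ∈ asm c r ch := fun e he =>
      (sissR_asm_mem_concat asm hasm c r ch e.1 j e.2).2 ⟨S, hS, he⟩
    have hchmem : ∀ (b : List (Fin k)) (j₁ : Fin k) (lab : Fin m × ℕ), (j₁ :: b, lab) ∈ S →
        (j₁ :: (b ++ [j]), lab) ∈ asm c r ch := fun b j₁ lab h =>
      (sissR_asm_mem_cons_concat asm hasm c r ch b j j₁ lab).2 ⟨S, hS, h⟩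
    have hchmem' : ∀ (b : List (Fin k)) (j₁ : Fin k) (lab : Fin m × ℕ),
        (j₁ :: (b ++ [j]), lab) ∈ asm c r ch → (j₁ :: b, lab) ∈ S := by
      intro b j₁ lab h
      obtain ⟨S', hS', h'⟩ := (sissR_asm_mem_cons_concat asm hasm c r ch b j j₁ lab).1 h
      rw [hS] at hS'
      cases hS'
      exact h'
    refine ⟨⟨?_, ?_, ?_⟩, ?_, ?_, ?_⟩
    · intro e he j₁ y s hys
      obtain ⟨hs, j', hj'⟩ := hloc1 _ (hmem e he) j₁ y s (hchmem e.1 j₁ (y, s) hys)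
      refine ⟨hs, j', ?_⟩
      rw [← sissW_childless_shift asm hasm c r ch j S hS j' (j₁ :: e.1)]
      exact hj'
    · intro e he j₁ y s hys hodd i₁ i₂ hi₁ hi₂
      refine hloc2 _ (hmem e he) j₁ y s (hchmem e.1 j₁ (y, s) hys) hodd i₁ i₂ ?_ ?_
      · rw [show (i₁ :: j₁ :: (e.1 ++ [j]) : List (Fin k)) = i₁ :: ((j₁ :: e.1) ++ [j]) from rfl,
          sissW_childless_shift asm hasm c r ch j S hS i₁ (j₁ :: e.1)]
        exact hi₁
      · rw [show (i₂ :: j₁ :: (e.1 ++ [j]) : List (Fin k)) = i₂ :: ((j₁ :: e.1) ++ [j]) from rfl,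
          sissW_childless_shift asm hasm c r ch j S hS i₂ (j₁ :: e.1)]
        exact hi₂
    · intro e he h1
      obtain ⟨j₁, y, s, hy, hs⟩ := hloc3 _ (hmem e he) h1
      exact ⟨j₁, y, s, hchmem' e.1 j₁ (y, s) hy, hs⟩
    · -- a childless root slot of `S`
      obtain ⟨lab, hlab⟩ := hroot j S hS
      have hch1 : ([j], lab) ∈ asm c r ch := (sissR_asm_mem_single asm hasm c r ch j lab).2 ⟨S, hS, hlab⟩
      obtain ⟨_, j', hj'⟩ := hloc1 _ hrootmem j lab.1 lab.2 hch1
      refine ⟨j', ?_⟩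
      rw [← sissW_childless_shift asm hasm c r ch j S hS j' []]
      exact hj'
    · -- uniqueness of the childless root slot of `S` when its code is odd
      intro y s hys hodd i₁ i₂ hi₁ hi₂
      have hch1 : ([j], (y, s)) ∈ asm c r ch :=
        (sissR_asm_mem_single asm hasm c r ch j (y, s)).2 ⟨S, hS, hys⟩
      refine hloc2 _ hrootmem j y s hch1 hodd i₁ i₂ ?_ ?_
      · rw [show (i₁ :: [j] : List (Fin k)) = i₁ :: ([] ++ [j]) from rfl,
          sissW_childless_shift asm hasm c r ch j S hS i₁ []]
        exact hi₁
      · rw [show (i₂ :: [j] : List (Fin k)) = i₂ :: ([] ++ [j]) from rfl,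
          sissW_childless_shift asm hasm c r ch j S hS i₂ []]
        exact hi₂
    · -- root round `< r / 2`
      intro y s hys
      have hch1 : ([j], (y, s)) ∈ asm c r ch :=
        (sissR_asm_mem_single asm hasm c r ch j (y, s)).2 ⟨S, hS, hys⟩
      exact (hloc1 _ hrootmem j y s hch1).1
  · intro h1
    obtain ⟨j, y, s, hy, hs⟩ := hloc3 _ hrootmem h1
    obtain ⟨S, hS, hy'⟩ := (sissR_asm_mem_single asm hasm c r ch j (y, s)).1 hy
    exact ⟨j, S, y, s, hS, hy', hs⟩

end TreeCompose

end Summit.PneNP.PneNP.Theorems
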